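import Summits.AtomisticToContinuum.Crystallization.Theorems.FrustratedLawDichotomyDoublingStationary

/-!
# FrustratedLawDichotomy · crux `AperiodicFrustratedLawGap` (stmt-AtomisticToContinuum-27623) — LAW-LEVEL DOUBLING, part 2:
# the class `K_w` (no pair of atoms `s, s'` with `‖s − s' + w‖ < 2`) is SETTLED modulo the energy floor
# (decomp-a2c, prover hand 2, structural share)

`eStar_lt_integral_rootEnergy_of_ae_noPair`: granted the floor of item 9229 (`e⋆ ≤ E_R[rootEnergy]` for every point-stationary hard-core
probability law `R`; hypothesis in Literature vocabulary, PROVED in the tree as `PalmUnimodularRigidity.UnimodularEnergyLowerBound`), every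
point-stationary `δ`-hard-core probability law `P` almost surely carried by configurations whose atoms satisfy `2 ≤ ‖s − s' + w‖` for all
`s, s'` has `e⋆ < E_P[rootEnergy]` — STRICTLY.  Proof: the symmetrised doubled law `Q' = ½(P∘D_w⁻¹ + P∘D_{-w}⁻¹)` is a point-stationary
`min δ 2`-hard-core probability law (part 1), and `E_{Q'}[h] = E_P[h] + ¼ E_P[C_w + C_{-w}]` with the cross terms
`C_u(μ) = ∫ V_LJ(‖z + u‖) dμ(z) < 0` (every atom of the copy is at distance `≥ 2 > 1` from the root, where `V_LJ < 0`); the floor for `Q'`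
gives `e⋆ ≤ E_{Q'}[h] < E_P[h]`.  This generalises "minimising laws charge no slabs" (`IsometryAtoms` stub `noSlabs`: a slab of width `D` with
unit normal `n`, `|⟨e_j, n⟩| ≥ 1/√3`, lies in `K_{t e_j}` for `t ≥ √3 (D + 2)`) with a two-copy transport in place of periodic stacking, and is a
SETTLED CLASS for the generic cut `aperiodicFrustratedLawGap_cut` (`aperiodicFrustratedLawGap_noPairCase`).  All `[folklore]`.
-/

noncomputable section

namespace Summit.AtomisticToContinuum.Crystallization.Theorems.FrustratedLawDichotomyFiniteClusterGap

open MeasureTheory Metric Set Filter ProbabilityTheory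
open scoped ENNReal Topology BigOperators
open Literature.MathematicalPhysics.StatisticalMechanics Literature.Probability.Process
open Summit.AtomisticToContinuum.Crystallization.Theorems.ChargedEnergyGapNegative (E3 eStar)
open Summit.AtomisticToContinuum.Crystallization.Theorems.BenjaminiSchrammLimit (measurableSet_setOf_isRootedHardCore)

section DoublingGap

variable {δ : ℝ} {P : Measure (Measure E3)}

/-! ### Root energy is integrable under laws carried by hard-core configurations -/

/-- **Integrability of the root energy.**  Under a finite measure almost surely carried by rooted `δ`-hard-core configurations the root
energy `ν ↦ rootEnergy V_LJ ν` is integrable (it agrees a.e. with a measurable function bounded by the shell bounds). [folklore] -/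
theorem integrable_rootEnergy_of_ae_hardCore (hδ : 0 < δ) {Q : Measure (Measure E3)} [IsFiniteMeasure Q]
    (hR : ∀ᵐ ν ∂Q, IsRootedHardCore δ ν) : Integrable (fun ν => rootEnergy lennardJones ν) Q := by
  obtain ⟨κ, hκs, hκS⟩ := exists_kernel_eq_count_restrict hδ
  obtain ⟨hp, hm⟩ := measurable_ofReal_lennardJones_parts
  set p : E3 → ℝ≥0∞ := fun z => ENNReal.ofReal (lennardJones ‖z‖) with hp_def
  set m : E3 → ℝ≥0∞ := fun z => ENNReal.ofReal (-lennardJones ‖z‖) with hm_def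
  set Hp : Measure E3 → ℝ≥0∞ := fun ν => ∫⁻ z, p z ∂(κ ν) with hHp_def
  set Hm : Measure E3 → ℝ≥0∞ := fun ν => ∫⁻ z, m z ∂(κ ν) with hHm_def
  have hHp : Measurable Hp := hp.lintegral_kernel
  have hHm : Measurable Hm := hm.lintegral_kernel
  have hLJm : Measurable fun y : E3 => lennardJones ‖y‖ := by
    have : Measurable lennardJones := by unfold lennardJones; fun_prop
    exact this.comp measurable_norm
  have hkey : ∀ᵐ ν ∂Q, Hp ν ≤ ENNReal.ofReal (250 / 12 * δ⁻¹ ^ 12) ∧ Hm ν ≤ ENNReal.ofReal (250 / 6 * δ⁻¹ ^ 6) ∧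
      rootEnergy lennardJones ν = ((Hp ν).toReal - (Hm ν).toReal) / 2 := by
    filter_upwards [hR] with ν hν
    obtain ⟨S, h0, hsep, rfl⟩ := hν
    have hκμ := hκS S hsep
    have hb := lintegral_lennardJones_parts_map_sub_le hδ hsep h0
    simp only [sub_zero, Measure.map_id'] at hb
    have hbp : Hp ((Measure.count : Measure E3).restrict S) ≤ ENNReal.ofReal (250 / 12 * δ⁻¹ ^ 12) := by
      simpa only [hHp_def, hκμ] using hb.1
    have hbm : Hm ((Measure.count : Measure E3).restrict S) ≤ ENNReal.ofReal (250 / 6 * δ⁻¹ ^ 6) := by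
      simpa only [hHm_def, hκμ] using hb.2
    refine ⟨hbp, hbm, ?_⟩
    have hHpμ : Hp ((Measure.count : Measure E3).restrict S) = ∫⁻ z, p z ∂((Measure.count : Measure E3).restrict S) := by
      simp only [hHp_def, hκμ]
    have hHmμ : Hm ((Measure.count : Measure E3).restrict S) = ∫⁻ z, m z ∂((Measure.count : Measure E3).restrict S) := by
      simp only [hHm_def, hκμ]
    rw [hHpμ] at hbp
    rw [hHmμ] at hbm
    have hint : Integrable (fun y : E3 => lennardJones ‖y‖) ((Measure.count : Measure E3).restrict S) := by
      refine ⟨hLJm.aestronglyMeasurable, ?_⟩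
      show ∫⁻ y, ‖lennardJones ‖y‖‖ₑ ∂((Measure.count : Measure E3).restrict S) < ∞
      calc ∫⁻ y, ‖lennardJones ‖y‖‖ₑ ∂((Measure.count : Measure E3).restrict S)
          ≤ ∫⁻ y, (p y + m y) ∂((Measure.count : Measure E3).restrict S) := lintegral_mono fun y => by
            simp only [hp_def, hm_def]
            rw [Real.enorm_eq_ofReal_abs]
            rcases le_total 0 (lennardJones ‖y‖) with h | h
            · rw [abs_of_nonneg h]; exact le_self_add
            · rw [abs_of_nonpos h]; exact le_add_self
        _ = (∫⁻ y, p y ∂((Measure.count : Measure E3).restrict S)) + ∫⁻ y, m y ∂((Measure.count : Measure E3).restrict S) :=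
            lintegral_add_left hp _
        _ < ∞ := ENNReal.add_lt_top.2 ⟨hbp.trans_lt ENNReal.ofReal_lt_top, hbm.trans_lt ENNReal.ofReal_lt_top⟩
    rw [rootEnergy_def, integral_eq_lintegral_pos_part_sub_lintegral_neg_part hint, hHpμ, hHmμ]
  have hintp : Integrable (fun ν => (Hp ν).toReal) Q :=
    Integrable.of_bound hHp.ennreal_toReal.aestronglyMeasurable (ENNReal.ofReal (250 / 12 * δ⁻¹ ^ 12)).toReal
      (hkey.mono fun ν h => by
        rw [Real.norm_eq_abs, abs_of_nonneg ENNReal.toReal_nonneg]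
        exact ENNReal.toReal_mono ENNReal.ofReal_ne_top h.1)
  have hintm : Integrable (fun ν => (Hm ν).toReal) Q :=
    Integrable.of_bound hHm.ennreal_toReal.aestronglyMeasurable (ENNReal.ofReal (250 / 6 * δ⁻¹ ^ 6)).toReal
      (hkey.mono fun ν h => by
        rw [Real.norm_eq_abs, abs_of_nonneg ENNReal.toReal_nonneg]
        exact ENNReal.toReal_mono ENNReal.ofReal_ne_top h.2.1)
  exact ((hintp.sub hintm).div_const 2).congr (hkey.mono fun ν h => h.2.2.symm)

/-! ### The cross term -/

/-- **The cross term of a configuration in `K_u`.**  For a rooted `δ`-hard-core `μ` whose atoms satisfy `2 ≤ ‖s − s' + u‖`: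
the Lennard-Jones field is integrable under the doubled configuration, the root energy of the doubled configuration splits as
`∫ V(‖z‖) d(D_u μ) = ∫ V(‖z‖) dμ + ∫ V(‖z + u‖) dμ`, the cross term is STRICTLY negative, and its negative part is bounded by the shell bound of
the doubled configuration. [folklore] -/
theorem cross_term_facts (hδ : 0 < δ) {μ : Measure E3} (hμ : IsRootedHardCore δ μ) {u : E3}
    (hK : ∀ s s' : E3, μ {s} ≠ 0 → μ {s'} ≠ 0 → 2 ≤ ‖s - s' + u‖) :
    Integrable (fun z : E3 => lennardJones ‖z + u‖) μ ∧
    ∫ z, lennardJones ‖z‖ ∂(μ + μ.map (fun z => z + u)) = ∫ z, lennardJones ‖z‖ ∂μ + ∫ z, lennardJones ‖z + u‖ ∂μ ∧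
    ∫ z, lennardJones ‖z + u‖ ∂μ < 0 ∧
    ∫⁻ z, ENNReal.ofReal (-lennardJones ‖z + u‖) ∂μ ≤ ENNReal.ofReal (250 / 6 * (min δ 2)⁻¹ ^ 6) ∧
    ∫⁻ z, ENNReal.ofReal (lennardJones ‖z + u‖) ∂μ = 0 := by
  have hδ' : 0 < min δ 2 := lt_min hδ two_pos
  have hD := isRootedHardCore_add_map_add hδ hμ hK
  have hLJm : Measurable fun y : E3 => lennardJones ‖y‖ := by
    have : Measurable lennardJones := by unfold lennardJones; fun_prop
    exact this.comp measurable_norm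
  -- integrability under the doubled configuration (a rooted `min δ 2`-hard-core configuration), via a one-atom law
  have hintD : Integrable (fun z : E3 => lennardJones ‖z‖) (μ + μ.map (fun z => z + u)) := by
    haveI : IsFiniteMeasure (Measure.dirac (μ + μ.map (fun z => z + u)) : Measure (Measure E3)) := by infer_instance
    obtain ⟨T, h0T, hsepT, hT⟩ := hD
    obtain ⟨hp, hm⟩ := measurable_ofReal_lennardJones_parts
    have hb := lintegral_lennardJones_parts_map_sub_le hδ' hsepT h0T
    simp only [sub_zero, Measure.map_id'] at hb
    rw [hT]
    refine ⟨hLJm.aestronglyMeasurable, ?_⟩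
    show ∫⁻ y, ‖lennardJones ‖y‖‖ₑ ∂((Measure.count : Measure E3).restrict T) < ∞
    calc ∫⁻ y, ‖lennardJones ‖y‖‖ₑ ∂((Measure.count : Measure E3).restrict T)
        ≤ ∫⁻ y, (ENNReal.ofReal (lennardJones ‖y‖) + ENNReal.ofReal (-lennardJones ‖y‖)) ∂((Measure.count : Measure E3).restrict T) :=
          lintegral_mono fun y => by
            rw [Real.enorm_eq_ofReal_abs]
            rcases le_total 0 (lennardJones ‖y‖) with h | h
            · rw [abs_of_nonneg h]; exact le_self_add
            · rw [abs_of_nonpos h]; exact le_add_self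
      _ = (∫⁻ y, ENNReal.ofReal (lennardJones ‖y‖) ∂((Measure.count : Measure E3).restrict T)) +
            ∫⁻ y, ENNReal.ofReal (-lennardJones ‖y‖) ∂((Measure.count : Measure E3).restrict T) := lintegral_add_left hp _
      _ < ∞ := ENNReal.add_lt_top.2 ⟨hb.1.trans_lt ENNReal.ofReal_lt_top, hb.2.trans_lt ENNReal.ofReal_lt_top⟩
  have hintμ : Integrable (fun z : E3 => lennardJones ‖z‖) μ := hintD.mono_measure (Measure.le_add_right le_rfl)
  have hintmap : Integrable (fun z : E3 => lennardJones ‖z‖) (μ.map (fun z => z + u)) :=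
    hintD.mono_measure (Measure.le_add_left le_rfl)
  have hintu : Integrable (fun z : E3 => lennardJones ‖z + u‖) μ :=
    (integrable_map_measure hLJm.aestronglyMeasurable (measurable_add_const u).aemeasurable).1 hintmap
  -- the splitting
  have hsplit : ∫ z, lennardJones ‖z‖ ∂(μ + μ.map (fun z => z + u)) = ∫ z, lennardJones ‖z‖ ∂μ + ∫ z, lennardJones ‖z + u‖ ∂μ := by
    rw [integral_add_measure hintμ hintmap, integral_map (measurable_add_const u).aemeasurable hLJm.aestronglyMeasurable]
  -- negativity and the bounds on the cross term
  obtain ⟨S, h0, hsep, rfl⟩ := hμ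
  have hK' : ∀ z ∈ S, 2 ≤ ‖z + u‖ := fun z hz => by
    have := hK z 0 ((count_restrict_singleton_ne_zero_iff S z).2 hz) ((count_restrict_singleton_ne_zero_iff S 0).2 h0)
    simpa using this
  have hneg_pt : ∀ z ∈ S, lennardJones ‖z + u‖ < 0 := fun z hz => lennardJones_neg (by linarith [hK' z hz])
  have hae : ∀ᵐ z ∂((Measure.count : Measure E3).restrict S), z ∈ S := ae_mem_of_sep hδ hsep
  refine ⟨hintu, hsplit, ?_, ?_, ?_⟩
  · -- strictly negative: `-∫ (-f) < 0` with `-f > 0` on the atom `0`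
    have hpos : 0 < ∫ z, -lennardJones ‖z + u‖ ∂((Measure.count : Measure E3).restrict S) := by
      rw [integral_pos_iff_support_of_nonneg_ae (hae.mono fun z hz => (neg_pos.2 (hneg_pt z hz)).le) hintu.neg]
      refine lt_of_lt_of_le ?_ (measure_mono (show ({0} : Set E3) ⊆ Function.support fun z => -lennardJones ‖z + u‖ from ?_))
      · rw [Measure.restrict_apply (measurableSet_singleton 0), Set.inter_eq_left.2 (Set.singleton_subset_iff.2 h0),
          Measure.count_singleton]
        exact one_pos
      · intro z hz
        rw [Set.mem_singleton_iff.1 hz, Function.mem_support]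
        exact (neg_pos.2 (hneg_pt 0 h0)).ne'
    rw [integral_neg] at hpos
    linarith
  · -- negative part: bounded by the shell bound of the doubled configuration
    obtain ⟨T, h0T, hsepT, hT⟩ := hD
    have hb := (lintegral_lennardJones_parts_map_sub_le hδ' hsepT h0T).2
    simp only [sub_zero, Measure.map_id'] at hb
    calc ∫⁻ z, ENNReal.ofReal (-lennardJones ‖z + u‖) ∂((Measure.count : Measure E3).restrict S)
        = ∫⁻ z, ENNReal.ofReal (-lennardJones ‖z‖) ∂(((Measure.count : Measure E3).restrict S).map (fun z => z + u)) :=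
          (lintegral_map measurable_ofReal_lennardJones_parts.2 (measurable_add_const u)).symm
      _ ≤ ∫⁻ z, ENNReal.ofReal (-lennardJones ‖z‖) ∂((Measure.count : Measure E3).restrict S +
            ((Measure.count : Measure E3).restrict S).map (fun z => z + u)) := lintegral_mono' (Measure.le_add_left le_rfl) le_rfl
      _ ≤ ENNReal.ofReal (250 / 6 * (min δ 2)⁻¹ ^ 6) := by rw [hT]; exact hb
  · -- positive part vanishes: all atoms of the copy are at distance `≥ 2 > 1`
    refine (lintegral_eq_zero_iff' ((measurable_ofReal_lennardJones_parts.1.comp (measurable_add_const u)).aemeasurable)).2 ?_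
    exact hae.mono fun z hz => by simp only [Pi.zero_apply]; exact ENNReal.ofReal_of_nonpos (hneg_pt z hz).le


/-! ### The class `K_w` is settled (modulo the floor) -/

/-- `e⋆ < 0`. [folklore] -/
private theorem eStar_neg₄ : eStar < 0 := by
  have h := card_mul_eStar_lt_interactionEnergy (N := 1) one_pos (x := fun _ => (0 : E3)) (fun i j _ => Subsingleton.elim i j)
  rw [interactionEnergy_of_subsingleton] at h
  simpa using h

/-- **The no-pair class `K_w` is settled.**  Granted the energy floor for point-stationary hard-core probability laws (item 9229, PROVED in
the tree; hypothesis in Literature vocabulary), every point-stationary `δ`-hard-core probability law almost surely carried by configurations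
whose atoms satisfy `2 ≤ ‖s − s' + w‖` for all atoms `s, s'` has mean root energy STRICTLY above `e⋆`. [folklore] -/
theorem eStar_lt_integral_rootEnergy_of_ae_noPair
    (hU : ∀ δ' : ℝ, 0 < δ' → ∀ Q : Measure (Measure E3), IsProbabilityMeasure Q → (∀ᵐ μ ∂Q, IsRootedHardCore δ' μ) →
      IsPointStationaryLaw Q → eStar ≤ ∫ μ, rootEnergy lennardJones μ ∂Q)
    (hδ : 0 < δ) [IsProbabilityMeasure P] (hcore : ∀ᵐ μ ∂P, IsRootedHardCore δ μ) (hstat : IsPointStationaryLaw P) (w : E3)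
    (hK : ∀ᵐ μ ∂P, ∀ s s' : E3, μ {s} ≠ 0 → μ {s'} ≠ 0 → 2 ≤ ‖s - s' + w‖) :
    eStar < ∫ μ, rootEnergy lennardJones μ ∂P := by
  -- junk case
  by_cases hint : Integrable (fun μ : Measure E3 => rootEnergy lennardJones μ) P
  swap
  · rw [integral_undef hint]; exact eStar_neg₄
  have hδ' : 0 < min δ 2 := lt_min hδ two_pos
  have hKm : ∀ᵐ μ ∂P, ∀ s s' : E3, μ {s} ≠ 0 → μ {s'} ≠ 0 → 2 ≤ ‖s - s' + -w‖ := by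
    filter_upwards [hK] with μ hμ s s' hs hs'
    rw [show s - s' + -w = -(s' - s + w) by abel, norm_neg]
    exact hμ s' s hs' hs
  -- per doubling map: hard core a.s., mass, and the energy identity `∫ h d(P∘D_u⁻¹) = ∫ h dP + ½ ∫ C_u dP` with `∫ C_u dP < 0`
  have hside : ∀ u : E3, (∀ᵐ μ ∂P, ∀ s s' : E3, μ {s} ≠ 0 → μ {s'} ≠ 0 → 2 ≤ ‖s - s' + u‖) →
      (∀ᵐ ν ∂(P.map (fun μ : Measure E3 => μ + μ.map (fun z => z + u))), IsRootedHardCore (min δ 2) ν) ∧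
      (P.map (fun μ : Measure E3 => μ + μ.map (fun z => z + u))) univ = 1 ∧
      Integrable (fun ν => rootEnergy lennardJones ν) (P.map (fun μ : Measure E3 => μ + μ.map (fun z => z + u))) ∧
      ∃ c : ℝ, c < 0 ∧ ∫ ν, rootEnergy lennardJones ν ∂(P.map (fun μ : Measure E3 => μ + μ.map (fun z => z + u))) =
        ∫ μ, rootEnergy lennardJones μ ∂P + c := by
    intro u hu
    have hDm : Measurable fun μ : Measure E3 => μ + μ.map (fun z => z + u) := measurable_add_map_add u
    have hHC : ∀ᵐ μ ∂P, IsRootedHardCore (min δ 2) (μ + μ.map (fun z => z + u)) := by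
      filter_upwards [hcore, hu] with μ hμ hμu
      exact isRootedHardCore_add_map_add hδ hμ hμu
    have hHCmap : ∀ᵐ ν ∂(P.map (fun μ : Measure E3 => μ + μ.map (fun z => z + u))), IsRootedHardCore (min δ 2) ν :=
      (ae_map_iff hDm.aemeasurable (measurableSet_setOf_isRootedHardCore hδ')).2 hHC
    have hmass : (P.map (fun μ : Measure E3 => μ + μ.map (fun z => z + u))) univ = 1 := by
      rw [Measure.map_apply hDm MeasurableSet.univ, Set.preimage_univ, measure_univ]
    haveI : IsFiniteMeasure (P.map (fun μ : Measure E3 => μ + μ.map (fun z => z + u))) :=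
      ⟨by rw [hmass]; exact ENNReal.one_lt_top⟩
    have hintD : Integrable (fun ν => rootEnergy lennardJones ν) (P.map (fun μ : Measure E3 => μ + μ.map (fun z => z + u))) :=
      integrable_rootEnergy_of_ae_hardCore hδ' hHCmap
    refine ⟨hHCmap, hmass, hintD, ?_⟩
    -- the cross term as a function of the configuration: measurable version and a.e. facts
    obtain ⟨hp, hm⟩ := measurable_ofReal_lennardJones_parts
    set Cr : Measure E3 → ℝ := fun μ =>
      (∫⁻ z, ENNReal.ofReal (lennardJones ‖z + u‖) ∂μ).toReal - (∫⁻ z, ENNReal.ofReal (-lennardJones ‖z + u‖) ∂μ).toReal with hCr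
    have hCrm : Measurable Cr :=
      (Measure.measurable_lintegral (hp.comp (measurable_add_const u))).ennreal_toReal.sub
        (Measure.measurable_lintegral (hm.comp (measurable_add_const u))).ennreal_toReal
    have hfacts : ∀ᵐ μ ∂P, rootEnergy lennardJones (μ + μ.map (fun z => z + u)) = rootEnergy lennardJones μ + Cr μ / 2 ∧
        Cr μ < 0 ∧ |Cr μ| ≤ (ENNReal.ofReal (250 / 6 * (min δ 2)⁻¹ ^ 6)).toReal := by
      filter_upwards [hcore, hu] with μ hμ hμu
      obtain ⟨hintu, hsplit, hneg, hbd, hzero⟩ := cross_term_facts hδ hμ hμu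
      have hC : ∫ z, lennardJones ‖z + u‖ ∂μ = Cr μ := by
        rw [hCr, integral_eq_lintegral_pos_part_sub_lintegral_neg_part hintu]
      refine ⟨?_, ?_, ?_⟩
      · rw [rootEnergy_def, rootEnergy_def, hsplit, hC]; ring
      · rw [← hC]; exact hneg
      · rw [← hC]
        have h1 : ∫ z, lennardJones ‖z + u‖ ∂μ =
            (∫⁻ z, ENNReal.ofReal (lennardJones ‖z + u‖) ∂μ).toReal - (∫⁻ z, ENNReal.ofReal (-lennardJones ‖z + u‖) ∂μ).toReal :=
          integral_eq_lintegral_pos_part_sub_lintegral_neg_part hintu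
        rw [h1, hzero, ENNReal.toReal_zero, zero_sub, abs_neg, abs_of_nonneg ENNReal.toReal_nonneg]
        exact ENNReal.toReal_mono ENNReal.ofReal_ne_top hbd
    have hCint : Integrable Cr P :=
      Integrable.of_bound hCrm.aestronglyMeasurable _ (hfacts.mono fun μ h => by rw [Real.norm_eq_abs]; exact h.2.2)
    have hCneg : ∫ μ, Cr μ ∂P < 0 := by
      have hpos : 0 < ∫ μ, -Cr μ ∂P := by
        have h0 : 0 ≤ ∫ μ, -Cr μ ∂P :=
          integral_nonneg_of_ae (hfacts.mono fun μ h => by show (0 : ℝ) ≤ -Cr μ; linarith [h.2.1])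
        rcases h0.lt_or_eq with h | h
        · exact h
        · exfalso
          have hz := (integral_eq_zero_iff_of_nonneg_ae (hfacts.mono fun μ h => by
            show (0 : ℝ) ≤ -Cr μ; linarith [h.2.1]) hCint.neg).1 h.symm
          have hfalse : ∀ᵐ μ ∂P, False := by
            filter_upwards [hfacts, hz] with μ h1 h2
            simp only [Pi.zero_apply, Pi.neg_apply, neg_eq_zero] at h2
            linarith [h1.2.1]
          exact IsProbabilityMeasure.ne_zero P (ae_eq_bot.1 (Filter.eventually_false_iff_eq_bot.1 hfalse))
      rw [integral_neg] at hpos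
      linarith
    refine ⟨(∫ μ, Cr μ ∂P) / 2, by linarith, ?_⟩
    rw [integral_map hDm.aemeasurable hintD.aestronglyMeasurable,
      integral_congr_ae (hfacts.mono fun μ h => h.1), integral_add hint (hCint.div_const 2), integral_div]
  -- the symmetrised doubled law and the floor
  obtain ⟨hHCp, hmassp, hintp, cp, hcp, hEp⟩ := hside w hK
  obtain ⟨hHCm, hmassm, hintm, cm, hcm, hEm⟩ := hside (-w) hKm
  set Q : Measure (Measure E3) := P.map (fun μ : Measure E3 => μ + μ.map (fun z => z + w)) +
    P.map (fun μ : Measure E3 => μ + μ.map (fun z => z + -w)) with hQ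
  have hQ' : IsProbabilityMeasure ((2 : ℝ≥0∞)⁻¹ • Q) := ⟨by
    rw [Measure.smul_apply, hQ, Measure.add_apply, hmassp, hmassm, smul_eq_mul]
    norm_num
    exact ENNReal.inv_mul_cancel two_ne_zero ENNReal.ofNat_ne_top⟩
  have hfloor := hU (min δ 2) hδ' ((2 : ℝ≥0∞)⁻¹ • Q) hQ'
    (Measure.ae_smul_measure ((ae_add_measure_iff).2 ⟨hHCp, hHCm⟩) _)
    ((isPointStationaryLaw_doubled hδ hcore hstat w hK).smul _)
  rw [integral_smul_measure, hQ, integral_add_measure hintp hintm, hEp, hEm, ENNReal.toReal_inv, ENNReal.toReal_ofNat,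
    smul_eq_mul] at hfloor
  linarith

end DoublingGap

end Summit.AtomisticToContinuum.Crystallization.Theorems.FrustratedLawDichotomyFiniteClusterGap

end
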